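import Literature.Combinatorics.Enumerative.MultivariateAperyGZeroBProofs
import Literature.Combinatorics.Enumerative.MultivariateAperyPrimePowerProofs
import Mathlib.Tactic
import HarnessLib

/-!
# Straub 2014, (25) for general `r` (PROVED): `B(p^r 𝐧) ≡ B(p^{r−1} 𝐧) (mod p^{3r})` for `𝐧 ∈ ℤ_{≥0}^3`

Topic `Literature/Combinatorics/Enumerative`, namespace `Literature.Combinatorics.Enumerative.MultivariateAperyPrimePowerProofs`
(the last file of the chain; uses `MultivariateAperyGZeroBProofs`, `MultivariateAperyJacobsthalRatioProofs` and
`sum_eq_sum_digits` of `MultivariateAperyPrimePowerProofs`). PROOF FILE: sorry-free theorems only — no definition,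
no named fact. It DISCHARGES the named fact `MultivariateAperyNumbers.example34_supercongruence` (Straub 2014,
Example 3.4 (25) = Theorem 3.2 (22) for `λ = (2,1)`, `ε = 1`, typed for `𝐧 ∈ ℤ_{≥0}^3`): «for `𝐧 ∈ ℤ³` and integers
`r ≥ 1`, the supercongruences (25) `B(p^r 𝐧) ≡ B(p^{r−1} 𝐧) (mod p^{3r})` hold for all primes `p ≥ 5`. In the
diagonal case `n₁ = n₂ = n₃`, this result was first proved by Coster» (held `paper:arxiv-1401.0854`, Example
3.4) — whose diagonal `B(n,n,n)` is Apéry's `ζ(2)` sequence (tree `straubB_diag`). Same route as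
`straubA_prime_pow_modEq`. HONEST FRAMING (cell pub-zeta5): a known prime-power supercongruence (Coster 1988 /
Straub 2014) for the Apéry numbers of `ζ(2)`; nothing about `ζ(5)` or any irrationality statement.

* `termB_modEq` — Lemma 5.3 (40) for λ = (2,1); **`straubB_prime_pow_modEq`** — (25);
  **`example34_supercongruence_holds : MultivariateAperyNumbers.example34_supercongruence`**.
[cite: Straub2014, Example 3.4 (25); Theorem 3.2 (22); Lemma 5.3]
-/

open Finset

namespace Literature.Combinatorics.Enumerative.MultivariateAperyPrimePowerProofs

open MultivariateAperyNumbers (straubB)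
open Literature.NumberTheory.Congruences (Jacobsthal.choose_mul_prime_pow_modEq)

section AssemblyB

variable {p : ℕ} [hp : Fact p.Prime]

/-- Unit-ratio relations multiply. [folklore] -/
private theorem ratio_mul' {N A A' B B' : ℕ}
    (hA : ∃ x y : ℕ, ¬ p ∣ y ∧ y * A = x * A' ∧ x ≡ y [MOD p ^ N])
    (hB : ∃ x y : ℕ, ¬ p ∣ y ∧ y * B = x * B' ∧ x ≡ y [MOD p ^ N]) :
    ∃ x y : ℕ, ¬ p ∣ y ∧ y * (A * B) = x * (A' * B') ∧ x ≡ y [MOD p ^ N] := by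
  obtain ⟨x₁, y₁, hy₁, h₁, hm₁⟩ := hA
  obtain ⟨x₂, y₂, hy₂, h₂, hm₂⟩ := hB
  refine ⟨x₁ * x₂, y₁ * y₂, fun h => ?_, ?_, hm₁.mul hm₂⟩
  · rcases (Nat.Prime.dvd_mul hp.out).mp h with h | h
    · exact hy₁ h
    · exact hy₂ h
  · calc y₁ * y₂ * (A * B) = (y₁ * A) * (y₂ * B) := by ring
      _ = (x₁ * A') * (x₂ * B') := by rw [h₁, h₂]
      _ = x₁ * x₂ * (A' * B') := by ring

omit hp in
/-- Unit-ratio relations weaken to smaller moduli. [folklore] -/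
private theorem ratio_of_le' {N N' A A' : ℕ} (hN : N' ≤ N)
    (hA : ∃ x y : ℕ, ¬ p ∣ y ∧ y * A = x * A' ∧ x ≡ y [MOD p ^ N]) :
    ∃ x y : ℕ, ¬ p ∣ y ∧ y * A = x * A' ∧ x ≡ y [MOD p ^ N'] := by
  obtain ⟨x, y, hy, h, hm⟩ := hA
  exact ⟨x, y, hy, h, hm.of_dvd (pow_dvd_pow p hN)⟩

/-- **Straub 2014, Lemma 5.3, (40), for λ = (2,1) and `𝐧 ∈ ℤ_{≥0}^3`**: for a prime `p ≥ 5`, `r, s ≥ 1`,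
`p ∤ k`, `k ≥ 1`: `A(p^r 𝐧; p^s k) ≡ A(p^{r−1} 𝐧; p^{s−1} k) (mod p^{3r})` with
`A(𝐦; K) = C(m₁, K) C(m₁+m₂−K, m₁) C(m₃, K)`. [cite: Straub2014, Lemma 5.3 (40)] -/
theorem termB_modEq (h3 : 3 < p) {r s : ℕ} (hr : 1 ≤ r) (hs : 1 ≤ s) {k : ℕ} (hk : 1 ≤ k) (hpk : ¬ p ∣ k)
    (n₁ n₂ n₃ : ℕ) :
    (((p ^ r * n₁).choose (p ^ s * k) * (p ^ r * n₁ + p ^ r * n₂ - p ^ s * k).choose (p ^ r * n₁) *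
        (p ^ r * n₃).choose (p ^ s * k) : ℕ) : ℤ) ≡
      (((p ^ (r - 1) * n₁).choose (p ^ (s - 1) * k) *
        (p ^ (r - 1) * n₁ + p ^ (r - 1) * n₂ - p ^ (s - 1) * k).choose (p ^ (r - 1) * n₁) *
        (p ^ (r - 1) * n₃).choose (p ^ (s - 1) * k) : ℕ) : ℤ) [ZMOD (p : ℤ) ^ (3 * r)] := by
  have hle : r + 2 * min r s ≤ r + s + min r s := by omega
  have h1 := ratio_of_le' hle (ratio_choose (p := p) h3 hr hs hk n₁)
  have h3' := ratio_of_le' hle (ratio_choose (p := p) h3 hr hs hk n₃)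
  have h2 := ratio_choose_sub (p := p) h3 hr hs k n₁ n₂
  have hall := ratio_mul' (ratio_mul' h1 h2) h3'
  have hdiv : p ^ (2 * (r - s)) ∣ (p ^ (r - 1) * n₁).choose (p ^ (s - 1) * k) *
      (p ^ (r - 1) * n₁ + p ^ (r - 1) * n₂ - p ^ (s - 1) * k).choose (p ^ (r - 1) * n₁) *
      (p ^ (r - 1) * n₃).choose (p ^ (s - 1) * k) := by
    rcases Nat.lt_or_ge s r with hsr | hrs
    swap
    · rw [show r - s = 0 by omega, mul_zero, pow_zero]; exact one_dvd _
    · have ha := pow_sub_dvd_choose (p := p) (show s - 1 ≤ r - 1 by omega) hk hpk n₁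
      have hb := pow_sub_dvd_choose (p := p) (show s - 1 ≤ r - 1 by omega) hk hpk n₃
      have h := mul_dvd_mul (ha.mul_right ((p ^ (r - 1) * n₁ + p ^ (r - 1) * n₂ - p ^ (s - 1) * k).choose
        (p ^ (r - 1) * n₁))) hb
      rw [show p ^ (r - 1 - (s - 1)) * p ^ (r - 1 - (s - 1)) = p ^ (2 * (r - s)) by
        rw [← pow_add]; congr 1; omega] at h
      exact h
  have := modEq_of_ratio hall hdiv
  rw [show r + 2 * min r s + 2 * (r - s) = 3 * r by omega] at this
  exact this

/-- **Straub 2014, (25) for `𝐧 ∈ ℤ_{≥0}^3`, PROVED** (Theorem 3.2 (22) for λ = (2,1), ε = 1): for a prime `p ≥ 5`,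
`r ≥ 1` and all `n₁, n₂, n₃ ≥ 0`, `B(p^r 𝐧) ≡ B(p^{r−1} 𝐧) (mod p^{3r})` for the coefficients
`B(𝐧) = Σ_k C(n₁,k) C(n₁+n₂−k,n₁) C(n₃,k)` of `1/((1−x₁−x₂)(1−x₃) − x₁x₂x₃)`, whose diagonal are Apéry's `ζ(2)`
numbers. Same route as `straubA_prime_pow_modEq`. [cite: Straub2014, Example 3.4 (25); Theorem 3.2 (22)] -/
theorem straubB_prime_pow_modEq (h5 : 5 ≤ p) {r : ℕ} (hr : 1 ≤ r) (n₁ n₂ n₃ : ℕ) :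
    (straubB (p ^ r * n₁) (p ^ r * n₂) (p ^ r * n₃) : ℤ) ≡
      straubB (p ^ (r - 1) * n₁) (p ^ (r - 1) * n₂) (p ^ (r - 1) * n₃) [ZMOD (p : ℤ) ^ (3 * r)] := by
  have hp' := hp.out
  have h3 : 3 < p := by omega
  set t : ℕ → ℤ := fun K => (((p ^ r * n₁).choose K * (p ^ r * n₁ + p ^ r * n₂ - K).choose (p ^ r * n₁) *
    (p ^ r * n₃).choose K : ℕ) : ℤ) with ht
  set t' : ℕ → ℤ := fun K => (((p ^ (r - 1) * n₁).choose K *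
    (p ^ (r - 1) * n₁ + p ^ (r - 1) * n₂ - K).choose (p ^ (r - 1) * n₁) * (p ^ (r - 1) * n₃).choose K : ℕ) : ℤ)
    with ht'
  have hNN' : p ^ (r - 1) * n₁ ≤ p ^ r * n₁ := Nat.mul_le_mul_right n₁ (Nat.pow_le_pow_right hp'.pos (by omega))
  have htN : ∀ K, p ^ r * n₁ < K → t K = 0 := fun K hK => by
    simp only [ht, Nat.choose_eq_zero_of_lt hK, zero_mul, Nat.cast_zero]
  have ht'N' : ∀ K, p ^ (r - 1) * n₁ < K → t' K = 0 := fun K hK => by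
    simp only [ht', Nat.choose_eq_zero_of_lt hK, zero_mul, Nat.cast_zero]
  have ht'N : ∀ K, p ^ r * n₁ < K → t' K = 0 := fun K hK => ht'N' K (lt_of_le_of_lt hNN' hK)
  have hA : (straubB (p ^ r * n₁) (p ^ r * n₂) (p ^ r * n₃) : ℤ) = ∑ K ∈ range (p ^ r * n₁ + 1), t K := by
    simp only [straubB, Nat.cast_sum, ht]
  have hA' : (straubB (p ^ (r - 1) * n₁) (p ^ (r - 1) * n₂) (p ^ (r - 1) * n₃) : ℤ) =
      ∑ K ∈ range (p ^ r * n₁ + 1), t' K := by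
    have h1 : (straubB (p ^ (r - 1) * n₁) (p ^ (r - 1) * n₂) (p ^ (r - 1) * n₃) : ℤ) =
        ∑ K ∈ range (p ^ (r - 1) * n₁ + 1), t' K := by
      simp only [straubB, Nat.cast_sum, ht']
    rw [h1]
    refine Finset.sum_subset (fun x hx => Finset.mem_range.mpr
      (by have := Finset.mem_range.mp hx; omega)) fun K _ hK' => ?_
    have hlt : ¬ K < p ^ (r - 1) * n₁ + 1 := fun h => hK' (Finset.mem_range.mpr h)
    exact ht'N' K (by omega)
  have hS : p ^ r * n₁ < p ^ (p ^ r * n₁ + 1) :=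
    (Nat.lt_pow_self hp'.one_lt).trans_le (Nat.pow_le_pow_right hp'.pos (by omega))
  rw [hA, hA', sum_eq_sum_digits (p := p) hS t htN, sum_eq_sum_digits (p := p) hS t' ht'N]
  refine Int.ModEq.add ?_ ?_
  · simp only [ht, ht', Nat.choose_zero_right, one_mul, mul_one, Nat.sub_zero]
    have h12 := Jacobsthal.choose_mul_prime_pow_modEq (p := p) h3 hr (n₁ + n₂) n₁
    rw [← Int.natCast_modEq_iff] at h12
    push_cast at h12 ⊢
    rw [show p ^ r * n₁ + p ^ r * n₂ = (n₁ + n₂) * p ^ r by ring,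
      show p ^ (r - 1) * n₁ + p ^ (r - 1) * n₂ = (n₁ + n₂) * p ^ (r - 1) by ring,
      show p ^ r * n₁ = n₁ * p ^ r by ring, show p ^ (r - 1) * n₁ = n₁ * p ^ (r - 1) by ring]
    exact h12
  · rw [Finset.sum_range_succ' (fun s => ∑ k ∈ range (p ^ r * n₁ + 1), if p ∣ k then 0 else t (p ^ s * k)),
      Finset.sum_range_succ (fun s => ∑ k ∈ range (p ^ r * n₁ + 1), if p ∣ k then 0 else t' (p ^ s * k))]
    have hG0 : ∑ k ∈ range (p ^ r * n₁ + 1), (if p ∣ k then 0 else t (p ^ 0 * k)) ≡ 0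
        [ZMOD (p : ℤ) ^ (3 * r)] := by
      simp only [pow_zero, one_mul, ht]
      exact Int.modEq_zero_iff_dvd.mpr (pow_dvd_sum_not_dvd_termB (p := p) h5 hr n₁ n₂ n₃)
    have hGtop : ∑ k ∈ range (p ^ r * n₁ + 1), (if p ∣ k then 0 else t' (p ^ (p ^ r * n₁) * k)) = 0 := by
      refine Finset.sum_eq_zero fun k _ => ?_
      split_ifs with hk
      · rfl
      · have hk1 : 1 ≤ k := Nat.one_le_iff_ne_zero.mpr fun h0 => hk (h0 ▸ dvd_zero p)
        apply ht'N
        have h1 : p ^ r * n₁ < p ^ (p ^ r * n₁) := Nat.lt_pow_self hp'.one_lt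
        have h2 : p ^ (p ^ r * n₁) ≤ p ^ (p ^ r * n₁) * k := Nat.le_mul_of_pos_right _ hk1
        omega
    have hGs : ∀ s ∈ range (p ^ r * n₁), ∑ k ∈ range (p ^ r * n₁ + 1), (if p ∣ k then 0 else t (p ^ (s + 1) * k)) ≡
        ∑ k ∈ range (p ^ r * n₁ + 1), (if p ∣ k then 0 else t' (p ^ s * k)) [ZMOD (p : ℤ) ^ (3 * r)] := by
      intro s _
      refine Int.ModEq.sum fun k _ => ?_
      split_ifs with hk
      · rfl
      · have hk1 : 1 ≤ k := Nat.one_le_iff_ne_zero.mpr fun h0 => hk (h0 ▸ dvd_zero p)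
        have h := termB_modEq (p := p) h3 hr (show 1 ≤ s + 1 by omega) hk1 hk n₁ n₂ n₃
        simp only [Nat.add_sub_cancel] at h
        simpa only [ht, ht'] using h
    rw [hGtop, add_zero]
    have := (Int.ModEq.sum hGs).add hG0
    rw [add_zero] at this
    exact this

/-- **Straub 2014, (25)** — the named fact `MultivariateAperyNumbers.example34_supercongruence` is a THEOREM;
on the diagonal this is the prime-power supercongruence for Apéry's `ζ(2)` numbers («first proved by Coster»).
[cite: Straub2014, Example 3.4 (25)] -/
theorem example34_supercongruence_holds : MultivariateAperyNumbers.example34_supercongruence := by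
  intro p hpr h5 r hr n₁ n₂ n₃
  haveI : Fact p.Prime := ⟨hpr⟩
  exact straubB_prime_pow_modEq (p := p) h5 hr n₁ n₂ n₃

end AssemblyB

end Literature.Combinatorics.Enumerative.MultivariateAperyPrimePowerProofs
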